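import Literature.Computability.AlgebraicComplexity.PolynomialKoszulYoungFlattening
import Literature.Barriers.ValiantsHypothesis.ShiftedPartialsPermanentSide
import HarnessLib

/-!
# Koszul–Young flattening ranks are bounded by the Hilbert function of the space of partials:
# `rank P^{∧p}_{k,d-k} ≤ min( h_P(k)·binom(N,p), h_P(k+1)·binom(N,p+1) )`

Topic `Literature/Computability/AlgebraicComplexity`; companion of `PolynomialKoszulYoungFlattening.lean`
(`kyRankFin`, `kyRank`) and of the tree's partial-derivative ranks (`shiftedPartialsRank K k 0 P = dim ⟨∂^{=k}P⟩`,
`Literature/Barriers/ValiantsHypothesis/`). Everything here is PROVED; no named facts.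

**The statement (source and target factorisations).** For `P ∈ S^dW`, `dim W = N`, the Koszul–Young flattening
`P^{∧p}_{k,d-k} : S^kW^* ⊗ Λ^pW → S^{d-k-1}W ⊗ Λ^{p+1}W`, `D ⊗ ω ↦ Σ_t ∂_t(DP) ⊗ (x_t ∧ ω)`
[cite: LandsbergGCT2017, §8.2.1 eq. (8.2.1)] [cite: Guan2016, §1.3]

* factors through `P_{k,d-k} ⊗ Id : S^kW^* ⊗ Λ^pW → ⟨∂^{=k}P⟩ ⊗ Λ^pW` (the image of `D ⊗ ω` depends on `D` only through
  `DP`), a space of dimension `h_P(k)·binom(N,p)` where `h_P(k) = dim ⟨∂^{=k}P⟩ = rank P_{k,d-k}` is the value of the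
  Hilbert function of the space of partials (of the apolar algebra) — so `rank ≤ h_P(k)·binom(N,p)`
  (`kyRankFin_le_shiftedPartialsRank_mul_choose`);
* has image inside `⟨∂^{=k+1}P⟩ ⊗ Λ^{p+1}W` (each `∂_t DP` is a partial of order `k+1`), of dimension
  `h_P(k+1)·binom(N,p+1)` — so `rank ≤ h_P(k+1)·binom(N,p+1)` (`kyRankFin_le_shiftedPartialsRank_succ_mul_choose`).

These are the two trivial ("no-syzygy") bounds by which the flattening method is compared with the dimension of
spaces of partial derivatives in print: Landsberg's `rank(P_{k,d-k})` discussion of the catalecticant inside the Young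
flattening [cite: LandsbergGCT2017, §8.2.1–8.2.2 (held PDF pp. 221–222)], Guan's computation of `rank (perm_n)_{k,n-k} =
binom(n,k)²` as the input of such comparisons [cite: Guan2016, §3.2], and ELSW's "what one would have if there were no
syzygies" count for the shifted cousin [cite: EfremenkoLandsbergSchenckWeyman2018, §1.1 and §6]. (Cell use: they are
the per-summand bounds `min(C(M,j)·h(k), C(M,j+1)·h(k+1))` of the padded-permanent side; this file states them for an
arbitrary polynomial, over any field.)

**What is here.** `kySourceMap S` (the `K`-linear map `g ↦ (T ↦ Σ_{j∉S,T=S∪j} ε(S,j) ∂_j g)`, so that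
`kyImage f l S = kySourceMap S (∂^l f)`), the two bounds for `kyRankFin` (variables `Fin q`) and for the numbering-free
`kyRank` (any finite variable type), and the `min` form `kyRankFin_le_min`.
-/

noncomputable section

open MvPolynomial

namespace Literature.Computability.AlgebraicComplexity

open Literature.Barriers.ValiantsHypothesis

variable {K : Type*} [Field K] {q : ℕ}

/-! ## The source factorisation `D ⊗ e_S ↦ (DP) ⊗ e_S ↦ image` -/

/-- The `K`-linear map `g ↦ (T ↦ Σ_j [j ∉ S, T = S ∪ {j}] ε(S,j) · ∂_j g)`: the Koszul–Young image of `g ⊗ e_S`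
(so that the image of the basis tensor `∂^l ⊗ e_S` is `kySourceMap S (∂^l P)`). [cite: Guan2016, §1.3] -/
def kySourceMap (S : Finset (Fin q)) :
    MvPolynomial (Fin q) K →ₗ[K] (Finset (Fin q) → MvPolynomial (Fin q) K) where
  toFun g := fun T => ∑ j, if j ∉ S ∧ T = insert j S then
    (koszulSign S j : MvPolynomial (Fin q) K) * pderiv j g else 0
  map_add' g h := by
    funext T
    simp only [Pi.add_apply, ← Finset.sum_add_distrib]
    refine Finset.sum_congr rfl fun j _ => ?_
    split_ifs <;> simp [mul_add]
  map_smul' c g := by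
    funext T
    simp only [Pi.smul_apply, RingHom.id_apply, Finset.smul_sum]
    refine Finset.sum_congr rfl fun j _ => ?_
    split_ifs <;> simp

/-- `kyImage f l S = kySourceMap S (∂^l f)`: the image of `∂^l ⊗ e_S` depends on `l` only through `∂^l f`.
[cite: Guan2016, §1.3] -/
theorem kyImage_eq_kySourceMap (f : MvPolynomial (Fin q) K) (l : List (Fin q)) (S : Finset (Fin q)) :
    kyImage f l S = kySourceMap S (iterPDeriv l f) := rfl

/-- The span of the Koszul–Young images lies in `Σ_{|S| = p} kySourceMap S (⟨∂^{=k} f⟩)`. [cite: Guan2016, §1.3] -/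
theorem span_kyImages_le_sup_source (p k : ℕ) (f : MvPolynomial (Fin q) K) :
    Submodule.span K (kyImages p k f) ≤
      ((Finset.univ : Finset (Fin q)).powersetCard p).sup
        fun S => (Submodule.span K (derivSet k f)).map (kySourceMap S) := by
  classical
  rw [Submodule.span_le]
  rintro _ ⟨l, S, hl, hS, rfl⟩
  have hSm : S ∈ (Finset.univ : Finset (Fin q)).powersetCard p :=
    Finset.mem_powersetCard.2 ⟨Finset.subset_univ S, hS⟩
  have hle : (Submodule.span K (derivSet k f)).map (kySourceMap S) ≤
      ((Finset.univ : Finset (Fin q)).powersetCard p).sup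
        fun S => (Submodule.span K (derivSet k f)).map (kySourceMap S) :=
    Finset.le_sup (f := fun S => (Submodule.span K (derivSet k f)).map (kySourceMap S)) hSm
  refine hle ⟨iterPDeriv l f, Submodule.subset_span ⟨l, hl, rfl⟩, ?_⟩
  rw [kyImage_eq_kySourceMap]

/-- **Source bound: `rank P^{∧p}_{k,d-k} ≤ h_P(k) · binom(N, p)`** (`h_P(k) = dim ⟨∂^{=k}P⟩ = rank P_{k,d-k}`, the
tree's `shiftedPartialsRank K k 0 P`; `N = q` variables). [cite: LandsbergGCT2017, §8.2.1 eq. (8.2.1)] [cite: Guan2016, §1.3 and §3.2] -/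
theorem kyRankFin_le_shiftedPartialsRank_mul_choose (p k : ℕ) (f : MvPolynomial (Fin q) K) :
    kyRankFin K p k f ≤ shiftedPartialsRank K k 0 f * q.choose p := by
  classical
  set V := Submodule.span K (derivSet k f) with hV
  haveI hVfin : Module.Finite K V := by
    rw [hV, ← shiftedPartials_zero_right]; exact finite_span_shiftedPartials k 0 f
  set W : Finset (Fin q) → Submodule K (Finset (Fin q) → MvPolynomial (Fin q) K) :=
    fun S => V.map (kySourceMap S) with hW
  calc kyRankFin K p k f
      ≤ Module.finrank K ↥(((Finset.univ : Finset (Fin q)).powersetCard p).sup W) :=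
        Submodule.finrank_mono (span_kyImages_le_sup_source p k f)
    _ ≤ ∑ S ∈ (Finset.univ : Finset (Fin q)).powersetCard p, Module.finrank K (W S) :=
        finrank_finset_sup_le_sum _ W
    _ ≤ ∑ _S ∈ (Finset.univ : Finset (Fin q)).powersetCard p, Module.finrank K V :=
        Finset.sum_le_sum fun S _ => Submodule.finrank_map_le _ _
    _ = shiftedPartialsRank K k 0 f * q.choose p := by
        rw [Finset.sum_const, smul_eq_mul, mul_comm, shiftedPartialsRank_zero_eq, ← hV,
          Finset.card_powersetCard, Finset.card_univ, Fintype.card_fin]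

/-! ## The target factorisation: images lie in `⟨∂^{=k+1} f⟩ ⊗ Λ^{p+1}` -/

/-- Each Koszul–Young image `kyImage f l S` (`|l| = k`, `|S| = p`) lies in
`Σ_{|T| = p+1} e_T ⊗ ⟨∂^{=k+1} f⟩` (every `∂_j ∂^l f` is a partial of order `k+1`, and `S ∪ {j}` has `p+1` elements).
[cite: Guan2016, §1.3] -/
theorem span_kyImages_le_sup_target (p k : ℕ) (f : MvPolynomial (Fin q) K) :
    Submodule.span K (kyImages p k f) ≤
      ((Finset.univ : Finset (Fin q)).powersetCard (p + 1)).sup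
        fun T => (Submodule.span K (derivSet (k + 1) f)).map
          (LinearMap.single K (fun _ : Finset (Fin q) => MvPolynomial (Fin q) K) T) := by
  classical
  set U := ((Finset.univ : Finset (Fin q)).powersetCard (p + 1)).sup
        fun T => (Submodule.span K (derivSet (k + 1) f)).map
          (LinearMap.single K (fun _ : Finset (Fin q) => MvPolynomial (Fin q) K) T) with hU
  rw [Submodule.span_le]
  rintro _ ⟨l, S, hl, hS, rfl⟩
  -- write the image as a sum of single vectors
  have hsum : kyImage f l S = ∑ j, if j ∉ S then
      Pi.single (M := fun _ : Finset (Fin q) => MvPolynomial (Fin q) K) (insert j S)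
        ((koszulSign S j : MvPolynomial (Fin q) K) * pderiv j (iterPDeriv l f)) else 0 := by
    funext T
    rw [kyImage_apply, Finset.sum_apply]
    refine Finset.sum_congr rfl fun j _ => ?_
    by_cases hj : j ∉ S
    · rw [if_pos hj, Pi.single_apply]
      by_cases hT : T = insert j S
      · rw [if_pos ⟨hj, hT⟩, if_pos hT]
      · rw [if_neg (fun h => hT h.2), if_neg hT]
    · rw [if_neg hj, if_neg (fun h => hj h.1), Pi.zero_apply]
  change kyImage f l S ∈ U
  rw [hsum]
  refine Submodule.sum_mem _ fun j _ => ?_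
  by_cases hj : j ∉ S
  · rw [if_pos hj]
    have hTm : insert j S ∈ (Finset.univ : Finset (Fin q)).powersetCard (p + 1) :=
      Finset.mem_powersetCard.2 ⟨Finset.subset_univ _, by rw [Finset.card_insert_of_notMem hj, hS]⟩
    have hle : (Submodule.span K (derivSet (k + 1) f)).map
        (LinearMap.single K (fun _ : Finset (Fin q) => MvPolynomial (Fin q) K) (insert j S)) ≤ U :=
      Finset.le_sup (f := fun T => (Submodule.span K (derivSet (k + 1) f)).map
        (LinearMap.single K (fun _ : Finset (Fin q) => MvPolynomial (Fin q) K) T)) hTm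
    refine hle ⟨(koszulSign S j : MvPolynomial (Fin q) K) * pderiv j (iterPDeriv l f), ?_, rfl⟩
    have hmem : pderiv j (iterPDeriv l f) ∈ Submodule.span K (derivSet (k + 1) f) :=
      Submodule.subset_span ⟨j :: l, by rw [List.length_cons, hl], by rw [iterPDeriv_cons]⟩
    rw [← zsmul_eq_mul]
    exact zsmul_mem hmem _
  · rw [if_neg hj]
    exact Submodule.zero_mem _

/-- **Target bound: `rank P^{∧p}_{k,d-k} ≤ h_P(k+1) · binom(N, p+1)`** (`h_P(k+1) = dim ⟨∂^{=k+1}P⟩`).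
[cite: LandsbergGCT2017, §8.2.1 eq. (8.2.1)] [cite: Guan2016, §1.3 and §3.2] -/
theorem kyRankFin_le_shiftedPartialsRank_succ_mul_choose (p k : ℕ) (f : MvPolynomial (Fin q) K) :
    kyRankFin K p k f ≤ shiftedPartialsRank K (k + 1) 0 f * q.choose (p + 1) := by
  classical
  set V := Submodule.span K (derivSet (k + 1) f) with hV
  haveI hVfin : Module.Finite K V := by
    rw [hV, ← shiftedPartials_zero_right]; exact finite_span_shiftedPartials (k + 1) 0 f
  set W : Finset (Fin q) → Submodule K (Finset (Fin q) → MvPolynomial (Fin q) K) :=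
    fun T => V.map (LinearMap.single K (fun _ : Finset (Fin q) => MvPolynomial (Fin q) K) T) with hW
  calc kyRankFin K p k f
      ≤ Module.finrank K ↥(((Finset.univ : Finset (Fin q)).powersetCard (p + 1)).sup W) :=
        Submodule.finrank_mono (span_kyImages_le_sup_target p k f)
    _ ≤ ∑ T ∈ (Finset.univ : Finset (Fin q)).powersetCard (p + 1), Module.finrank K (W T) :=
        finrank_finset_sup_le_sum _ W
    _ ≤ ∑ _T ∈ (Finset.univ : Finset (Fin q)).powersetCard (p + 1), Module.finrank K V :=
        Finset.sum_le_sum fun T _ => Submodule.finrank_map_le _ _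
    _ = shiftedPartialsRank K (k + 1) 0 f * q.choose (p + 1) := by
        rw [Finset.sum_const, smul_eq_mul, mul_comm, shiftedPartialsRank_zero_eq, ← hV,
          Finset.card_powersetCard, Finset.card_univ, Fintype.card_fin]

/-- **`rank P^{∧p}_{k,d-k} ≤ min( h_P(k)·binom(N,p), h_P(k+1)·binom(N,p+1) )`.**
[cite: LandsbergGCT2017, §8.2.1 eq. (8.2.1)] [cite: Guan2016, §1.3] -/
theorem kyRankFin_le_min (p k : ℕ) (f : MvPolynomial (Fin q) K) :
    kyRankFin K p k f ≤ min (shiftedPartialsRank K k 0 f * q.choose p)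
      (shiftedPartialsRank K (k + 1) 0 f * q.choose (p + 1)) :=
  le_min (kyRankFin_le_shiftedPartialsRank_mul_choose p k f)
    (kyRankFin_le_shiftedPartialsRank_succ_mul_choose p k f)

/-! ## Numbering-free versions (`kyRank`, any finite variable type) -/

section AnyVars

variable {σ : Type*} [Fintype σ] [DecidableEq σ]

/-- `rank P^{∧p}_{k,d-k} ≤ h_P(k) · binom(#σ, p)` for a polynomial in the variables `σ`.
[cite: LandsbergGCT2017, §8.2.1 eq. (8.2.1)] [cite: Guan2016, §1.3] -/
theorem kyRank_le_shiftedPartialsRank_mul_choose (p k : ℕ) (f : MvPolynomial σ K) :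
    kyRank K p k f ≤ shiftedPartialsRank K k 0 f * (Fintype.card σ).choose p := by
  rw [kyRank_def]
  refine (kyRankFin_le_shiftedPartialsRank_mul_choose p k _).trans ?_
  exact Nat.mul_le_mul_right _
    (shiftedPartialsRank_zero_rename_le (Fintype.equivFin σ).injective k f)

/-- `rank P^{∧p}_{k,d-k} ≤ h_P(k+1) · binom(#σ, p+1)` for a polynomial in the variables `σ`.
[cite: LandsbergGCT2017, §8.2.1 eq. (8.2.1)] [cite: Guan2016, §1.3] -/
theorem kyRank_le_shiftedPartialsRank_succ_mul_choose (p k : ℕ) (f : MvPolynomial σ K) :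
    kyRank K p k f ≤ shiftedPartialsRank K (k + 1) 0 f * (Fintype.card σ).choose (p + 1) := by
  rw [kyRank_def]
  refine (kyRankFin_le_shiftedPartialsRank_succ_mul_choose p k _).trans ?_
  exact Nat.mul_le_mul_right _
    (shiftedPartialsRank_zero_rename_le (Fintype.equivFin σ).injective (k + 1) f)

end AnyVars

end Literature.Computability.AlgebraicComplexity
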